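/-
Copyright: the b2b-balaban T⁴-continuum CRUX team, row NE7b OWNER lineage `t4-ne7b-p1` (gen 131). Project licence.
-/
import Summits.QuantumFields.BalabanUV.T4Continuum.Spine.NE7b.SupLargeFieldComponentPaid

/-!
# THE COMPONENT PENALTY IS AN INTEGRABLE RANDOM VARIABLE — the bookkeeping (343) left open: the selector `K(ψ)` of the component of `q` in
# the large set `T(ψ) = {p ∈ C : Ψ² ≤ Σ_{cell p}ψ²}` is a function of the finite vector of large-cell events, so `ψ ↦ ∏_{p∈K(ψ)}e^{a}e^{bΣ_{cell p}ψ²}`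
# is a finite sum over the patterns `T ⊆ C` of `1_{T(ψ)=T}·∏_{p∈K_T}(…)`, hence MEASURABLE, and by (343)'s domination INTEGRABLE with
# `∫ ≤ 1 + 2η″` — (343)'s bound is an honest expectation bound (row NE7b, node U5c; (343)∕(335)∕(308) BY NAME; [folklore])

Cell `pub-balaban`, sub-cell `t4`, spine estimate NE7b (`T4WeightBudget.RelWeightBound`; the cell's OWN estimate — NOT PRINTED in
[Bałaban 1983–89], NOT PROVED).  Crux-route work under `Spine/NE7b/` by the row OWNER (`t4-ne7b-p1` gen 131, file (344)) under FREEZE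
(0)'s crux-prover clause, on § [NE7bP1-G130-HANDOFF] NEXT (3)(d); NOTHING of Bałaban's is named as a Lean object, valued or asserted; no
`T4Continuum/Support` leaf typed; no `def`, no notation; zero `sorry`.  Imports (BY NAME): the OWNER's (343) `…SupLargeFieldComponentPaid`
(`prod_component_le_one_add_sum`, `integral_component_penalty_le`; through it (335), (308) `integrable_prod_cellWeight`).

WHAT IS PROVED ([folklore]):
* §1 `component_eq_filter` (a selector characterised by reachability IS the filter of the large set — uniqueness), `largeSet_eq_iff`
  (`T(ψ) = T ↔ ∀ p ∈ C, (p large ↔ p ∈ T)`), `measurableSet_largeSet_eq` (the pattern events are measurable), `measurable_prod_weight`;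
* §2 THE END **`measurable_component_penalty`**, **`integrable_component_penalty`** (with (343): the component penalty is an integrable random
  variable of expectation `≤ 1 + 2η″`); §3 toy.

HONEST (what this is NOT).  Measure-theoretic bookkeeping for (343); one pair of scales; scalar skeleton ((A3), NC-NE7b-α UNRULED); nothing of
Bałaban's asserted.  BY-NAME EFFECT ON THE WALL: NONE.  NE7b NOT PRINTED ∕ NOT PROVED; spine PROVED 0∕9; rung (B)+1 — the programme's measures
remain FINITE-torus statements; NOT the mass gap, NOT Clay.  HONEST DEPENDENCY: continuum YM on T⁴ ⇐ BetaPertH ∧ nine spine estimates (0∕9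
proved); BetaPertH ⇐ (D1) ∧ (D4) ∧ CAP+tail; G-an2-4 gates asym, D1 and NE2∕3∕4.
-/

set_option autoImplicit false

noncomputable section

namespace Summit.QuantumFields.BalabanUV.T4Continuum.NE7b.SupLargeFieldComponentMeasurable

open MeasureTheory ProbabilityTheory Finset Real
open scoped BigOperators
open Literature.Probability.LatticeModels (IsRConnected rconnSubsets mem_rconnSubsets)
open SupLargeFieldComponentPaid (prod_component_le_one_add_sum integral_component_penalty_le)
open SupLargeFieldPenaltyPaid (integrable_prod_cellWeight)

variable {V : Type*} [DecidableEq V] {R : V → V → Prop}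

/-! ## §1. The selector is the filter of the large set; the pattern events are measurable -/

omit [DecidableEq V] in
/-- **Uniqueness of the selector**: a set characterised by reachability from `q` inside `T` IS the (classical) filter of `T`. [folklore] -/
theorem component_eq_filter {T K : Finset V} {q : V}
    (hK : ∀ p, p ∈ K ↔ p ∈ T ∧ Relation.ReflTransGen (fun a b => R a b ∧ a ∈ T ∧ b ∈ T) q p) :
    K = by classical exact T.filter fun p => Relation.ReflTransGen (fun a b => R a b ∧ a ∈ T ∧ b ∈ T) q p := by
  classical
  ext p
  rw [hK p, mem_filter]

variable {ι : Type} [Fintype ι] [DecidableEq ι]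

omit [DecidableEq V] [Fintype ι] [DecidableEq ι] in
/-- `T(ω) = T ↔ ∀ p ∈ C, (Ψ² ≤ Σ_{cell p}ω² ↔ p ∈ T)` for `T ⊆ C`. [folklore] -/
theorem largeSet_eq_iff (cell : V → Finset ι) (C T : Finset V) (hT : T ⊆ C) (Ψ : ℝ) (ω : EuclideanSpace ℝ ι) :
    C.filter (fun p => Ψ ^ 2 ≤ ∑ x ∈ cell p, ω x ^ 2) = T ↔ ∀ p ∈ C, (Ψ ^ 2 ≤ ∑ x ∈ cell p, ω x ^ 2 ↔ p ∈ T) := by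
  constructor
  · intro h p hp
    rw [← h, mem_filter]
    exact ⟨fun hl => ⟨hp, hl⟩, fun hm => hm.2⟩
  · intro h
    ext p
    rw [mem_filter]
    exact ⟨fun hm => (h p hm.1).1 hm.2, fun hp => ⟨hT hp, (h p (hT hp)).2 hp⟩⟩

omit [Fintype ι] [DecidableEq ι] in
/-- **The pattern events are measurable**: `{ω : T(ω) = T}` is measurable for every `T ⊆ C`. [folklore] -/
theorem measurableSet_largeSet_eq (cell : V → Finset ι) (C T : Finset V) (hT : T ⊆ C) (Ψ : ℝ) :
    MeasurableSet {ω : EuclideanSpace ℝ ι | C.filter (fun p => Ψ ^ 2 ≤ ∑ x ∈ cell p, ω x ^ 2) = T} := by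
  have hS : ∀ p, Measurable fun ω : EuclideanSpace ℝ ι => ∑ x ∈ cell p, ω x ^ 2 := fun p =>
    Finset.measurable_sum _ fun x _ => (by fun_prop : Measurable fun ω : EuclideanSpace ℝ ι => ω x).pow_const 2
  have hL : ∀ p, MeasurableSet {ω : EuclideanSpace ℝ ι | Ψ ^ 2 ≤ ∑ x ∈ cell p, ω x ^ 2} := fun p =>
    measurableSet_le measurable_const (hS p)
  have e : {ω : EuclideanSpace ℝ ι | C.filter (fun p => Ψ ^ 2 ≤ ∑ x ∈ cell p, ω x ^ 2) = T} =
      ⋂ p ∈ C, (if p ∈ T then {ω : EuclideanSpace ℝ ι | Ψ ^ 2 ≤ ∑ x ∈ cell p, ω x ^ 2}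
        else {ω : EuclideanSpace ℝ ι | Ψ ^ 2 ≤ ∑ x ∈ cell p, ω x ^ 2}ᶜ) := by
    ext ω
    rw [Set.mem_setOf_eq, largeSet_eq_iff cell C T hT Ψ ω, Set.mem_iInter₂]
    refine forall₂_congr fun p _ => ?_
    split_ifs with hp
    · simp only [Set.mem_setOf_eq]
      exact ⟨fun h => h.2 hp, fun h => ⟨fun _ => hp, fun _ => h⟩⟩
    · simp only [Set.mem_compl_iff, Set.mem_setOf_eq]
      exact ⟨fun h hl => hp (h.1 hl), fun h => ⟨fun hl => absurd hl h, fun hm => absurd hm hp⟩⟩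
  rw [e]
  refine Finset.measurableSet_biInter C fun p _ => ?_
  split_ifs
  · exact hL p
  · exact (hL p).compl

omit [DecidableEq V] [Fintype ι] [DecidableEq ι] in
/-- The weight of a FIXED region is measurable in the field. [folklore] -/
theorem measurable_prod_weight (cell : V → Finset ι) (L : Finset V) (a b : ℝ) :
    Measurable fun ω : EuclideanSpace ℝ ι => ∏ p ∈ L, (exp a * exp (b * ∑ x ∈ cell p, ω x ^ 2)) := by
  refine Finset.measurable_prod _ fun p _ => ?_
  have hS : Measurable fun ω : EuclideanSpace ℝ ι => ∑ x ∈ cell p, ω x ^ 2 :=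
    Finset.measurable_sum _ fun x _ => (by fun_prop : Measurable fun ω : EuclideanSpace ℝ ι => ω x).pow_const 2
  exact (measurable_exp.comp (hS.const_mul b)).const_mul _

/-! ## §2. THE END: the component penalty is measurable and integrable -/

omit [Fintype ι] [DecidableEq ι] in
/-- **THE COMPONENT PENALTY IS MEASURABLE**: for any selector `K(ω)` of the component of `q` in the large set,
`ω ↦ ∏_{p∈K(ω)} e^{a}e^{bΣ_{cell p}ω²}` is measurable (a finite sum over the patterns `T ⊆ C`). [folklore] -/
theorem measurable_component_penalty (cell : V → Finset ι) (C : Finset V) (q : V) (Ψ a b : ℝ) (K : EuclideanSpace ℝ ι → Finset V)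
    (hK : ∀ ω p, p ∈ K ω ↔ p ∈ C.filter (fun p => Ψ ^ 2 ≤ ∑ x ∈ cell p, ω x ^ 2) ∧
      Relation.ReflTransGen (fun a c => R a c ∧ a ∈ C.filter (fun p => Ψ ^ 2 ≤ ∑ x ∈ cell p, ω x ^ 2) ∧
        c ∈ C.filter (fun p => Ψ ^ 2 ≤ ∑ x ∈ cell p, ω x ^ 2)) q p) :
    Measurable fun ω : EuclideanSpace ℝ ι => ∏ p ∈ K ω, (exp a * exp (b * ∑ x ∈ cell p, ω x ^ 2)) := by
  classical
  -- the pattern decomposition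
  have e : ∀ ω : EuclideanSpace ℝ ι, ∏ p ∈ K ω, (exp a * exp (b * ∑ x ∈ cell p, ω x ^ 2)) =
      ∑ T ∈ C.powerset, if C.filter (fun p => Ψ ^ 2 ≤ ∑ x ∈ cell p, ω x ^ 2) = T then
        ∏ p ∈ T.filter (fun p => Relation.ReflTransGen (fun a c => R a c ∧ a ∈ T ∧ c ∈ T) q p),
          (exp a * exp (b * ∑ x ∈ cell p, ω x ^ 2)) else 0 := fun ω => by
    rw [sum_eq_single_of_mem (C.filter (fun p => Ψ ^ 2 ≤ ∑ x ∈ cell p, ω x ^ 2))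
      (mem_powerset.2 (filter_subset _ _)) (fun T _ hT => if_neg (Ne.symm hT)), if_pos rfl,
      component_eq_filter (hK ω)]
  have em : (fun ω : EuclideanSpace ℝ ι => ∏ p ∈ K ω, (exp a * exp (b * ∑ x ∈ cell p, ω x ^ 2))) =
      fun ω => ∑ T ∈ C.powerset, if C.filter (fun p => Ψ ^ 2 ≤ ∑ x ∈ cell p, ω x ^ 2) = T then
        ∏ p ∈ T.filter (fun p => Relation.ReflTransGen (fun a c => R a c ∧ a ∈ T ∧ c ∈ T) q p),
          (exp a * exp (b * ∑ x ∈ cell p, ω x ^ 2)) else 0 := funext e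
  rw [em]
  refine Finset.measurable_sum _ fun T hT => ?_
  exact Measurable.ite (measurableSet_largeSet_eq cell C T (mem_powerset.1 hT) Ψ) (measurable_prod_weight cell _ a b) measurable_const

/-- **THE COMPONENT PENALTY IS INTEGRABLE, WITH EXPECTATION `≤ 1 + 2η″`** ((343)'s hypotheses): measurable by §2, dominated pointwise by
(335)'s integrable summed weight `1 + Σ_{L}∏_{p∈L}(1_{p large}e^{a}e^{bΣψ²})`. [folklore] -/
theorem integrable_component_penalty {Γ : Matrix ι ι ℝ} {γop γ : ℝ} (hΓ : Γ.PosSemidef)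
    (hΓop : (γop • (1 : Matrix ι ι ℝ) - Γ).PosSemidef) (hdiag : ∀ i, Γ i i ≤ γ) (hγ : 0 ≤ γ) (cell : V → Finset ι)
    (hdisj : ∀ p q, p ≠ q → Disjoint (cell p) (cell q)) {v : ℕ} (hv : ∀ p, (cell p).card ≤ v)
    (hR : ∀ x y, R x y → R y x) {nbr : V → Finset V} {Δ : ℕ} (hΔ : ∀ x, (nbr x).card ≤ Δ) (hnbr : ∀ x y, R x y → y ∈ nbr x)
    {κ θ b : ℝ} (hκ : 0 ≤ κ) (hθ0 : 0 < θ) (hθ1 : θ < 1) (hκθ : κ * γop ≤ θ) (hb : b ≤ κ / 2) (Ψ a : ℝ)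
    (hsmall : ((Δ : ℝ) + 1) ^ 2 * (exp a * (exp (-((κ / 2 - b) * Ψ ^ 2)) * ((1 - θ) ^ (-(κ * γ / (2 * θ)))) ^ v)) ≤ 1 / 2)
    (C : Finset V) (q : V) (K : EuclideanSpace ℝ ι → Finset V)
    (hK : ∀ ω p, p ∈ K ω ↔ p ∈ C.filter (fun p => Ψ ^ 2 ≤ ∑ x ∈ cell p, ω x ^ 2) ∧
      Relation.ReflTransGen (fun a c => R a c ∧ a ∈ C.filter (fun p => Ψ ^ 2 ≤ ∑ x ∈ cell p, ω x ^ 2) ∧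
        c ∈ C.filter (fun p => Ψ ^ 2 ≤ ∑ x ∈ cell p, ω x ^ 2)) q p) :
    Integrable (fun ω : EuclideanSpace ℝ ι => ∏ p ∈ K ω, (exp a * exp (b * ∑ x ∈ cell p, ω x ^ 2))) (multivariateGaussian 0 Γ) ∧
      ∫ ω : EuclideanSpace ℝ ι, ∏ p ∈ K ω, (exp a * exp (b * ∑ x ∈ cell p, ω x ^ 2)) ∂(multivariateGaussian 0 Γ) ≤
        1 + 2 * (exp a * (exp (-((κ / 2 - b) * Ψ ^ 2)) * ((1 - θ) ^ (-(κ * γ / (2 * θ)))) ^ v)) := by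
  set μ := multivariateGaussian 0 Γ with hμ
  set 𝒴 : Finset (Finset V) := (rconnSubsets R C).filter fun L => q ∈ L with h𝒴
  refine ⟨?_, integral_component_penalty_le hΓ hΓop hdiag hγ cell hdisj hv hR hΔ hnbr hκ hθ0 hθ1 hκθ hb Ψ a hsmall C q K hK⟩
  -- the dominating summed weight, as in (343)
  have hpt : ∀ ω : EuclideanSpace ℝ ι, ∏ p ∈ K ω, (exp a * exp (b * ∑ x ∈ cell p, ω x ^ 2)) ≤
      1 + ∑ L ∈ 𝒴, ∏ p ∈ L, ((if Ψ ^ 2 ≤ ∑ x ∈ cell p, ω x ^ 2 then (1 : ℝ) else 0) *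
        (exp a * exp (b * ∑ x ∈ cell p, ω x ^ 2))) := fun ω => by
    have hTC : C.filter (fun p => Ψ ^ 2 ≤ ∑ x ∈ cell p, ω x ^ 2) ⊆ C := filter_subset _ _
    have e : ∏ p ∈ K ω, (exp a * exp (b * ∑ x ∈ cell p, ω x ^ 2)) =
        ∏ p ∈ K ω, ((if Ψ ^ 2 ≤ ∑ x ∈ cell p, ω x ^ 2 then (1 : ℝ) else 0) * (exp a * exp (b * ∑ x ∈ cell p, ω x ^ 2))) :=
      prod_congr rfl fun p hp => by
        have hlarge : Ψ ^ 2 ≤ ∑ x ∈ cell p, ω x ^ 2 := (mem_filter.1 ((hK ω p).1 hp).1).2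
        rw [if_pos hlarge, one_mul]
    rw [e]
    exact prod_component_le_one_add_sum (hK ω) hR hTC
      (fun p _ => mul_nonneg (by split_ifs <;> norm_num) (by positivity))
  have hI : ∀ L ∈ 𝒴, Integrable (fun ω : EuclideanSpace ℝ ι => ∏ p ∈ L, ((if Ψ ^ 2 ≤ ∑ x ∈ cell p, ω x ^ 2 then (1 : ℝ) else 0) *
      (exp a * exp (b * ∑ x ∈ cell p, ω x ^ 2)))) μ := fun L _ => integrable_prod_cellWeight hΓ hΓop cell hdisj hκ hθ1 hκθ hb L Ψ a
  have hRHS : Integrable (fun ω : EuclideanSpace ℝ ι => 1 + ∑ L ∈ 𝒴, ∏ p ∈ L, ((if Ψ ^ 2 ≤ ∑ x ∈ cell p, ω x ^ 2 then (1 : ℝ) else 0) *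
      (exp a * exp (b * ∑ x ∈ cell p, ω x ^ 2)))) μ := (integrable_const (1 : ℝ)).add (integrable_finsetSum 𝒴 hI)
  refine hRHS.mono' (measurable_component_penalty cell C q Ψ a b K hK).aestronglyMeasurable (ae_of_all _ fun ω => ?_)
  rw [Real.norm_eq_abs, abs_of_nonneg (prod_nonneg fun p _ => by positivity)]
  exact hpt ω

/-! ## §3. Toy -/

/-- Toy (§1): on the empty volume the large set is empty at every field, so the pattern criterion holds with `T = ∅`. -/
example (cell : Unit → Finset (Fin 1)) (ω : EuclideanSpace ℝ (Fin 1)) :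
    (∅ : Finset Unit).filter (fun p => (1 : ℝ) ^ 2 ≤ ∑ x ∈ cell p, ω x ^ 2) = ∅ :=
  (largeSet_eq_iff cell ∅ ∅ (Finset.Subset.refl _) 1 ω).2 (fun p hp => absurd hp (Finset.notMem_empty p))

end Summit.QuantumFields.BalabanUV.T4Continuum.NE7b.SupLargeFieldComponentMeasurable
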